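import Summits.CriticalPhenomena.PercolationContinuityZ3.Theorems.PercNearOneGluingNoHeavyLowerTailSahiE3ExchangeNestedTrace
import Mathlib.Tactic.Linarith
import Mathlib.Tactic.Ring
import Mathlib.Tactic.Positivity
import HarnessLib
import HarnessLib.Audit

/-!
# `NoHeavyLowerTail` (crux stmt-CriticalPhenomena-4575), Sahi programme P4: the 2×2 exchange lemma — nested TRACES via relative saturation (corner O′ and type-1 variants)

Support file (cell `prim-l12`, seat P4, generation 22; `--supports stmt-CriticalPhenomena-4575`).  No named facts, no sorries;
standard axioms; def-free.

Context (HOME prim-l12-p4/FROM-prim-l12-p4-gen22-SATURATION.md F1).  `…SahiE3ExchangeNested.exchange_nestedLK_cornerO` proves the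
type-2 exchange lemma when the unprimed SETS are nested (`L ⊆ K`) and the corner `O` misses the slot.  Composed with the
phantom monotonicity `…SahiE3ExchangePhantom.phantom_antitone₂` (the relative-saturation reduction of gen 22) it extends to
configurations whose unprimed sets need not be nested but admit nested ENLARGEMENTS with the same traces: up-sets
`K ⊆ K₂ ⊆ P`, `L ⊆ L₂ ⊆ P`, `K' ⊆ K₂' ⊆ P'`, `L' ⊆ L₂' ⊆ P'` with `X₂ ∩ V = X ∩ V` and `L₂ ⊆ K₂`.  The canonical choice is the
relative saturation `X₂ = P ∩ sat_V(X)` (largest up-set inside `P` with the trace of `X`); since `T ↦ P ∩ sat_V(T)` is monotone,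
such nested enlargements exist exactly when the TRACES are nested, `L ∩ V ⊆ K ∩ V`.  So (type 2, class I) the exchange lemma holds
for every configuration with nested unprimed traces — for every `R ≥ 0` on `V` satisfying the pair inequality at the two diamond
pairs `(K₂, K₂'∩L₂')`, `(L₂, K₂'∪L₂')` of the enlarged configuration (both footprints lie under the supply `1_{KK'V} + 1_{LL'V}`,
which depends on the traces only).  The remaining open case of the lemma in classes I/II is "both sides trace-incomparable"
(conjecture H of the memo covers it numerically).  This file adds to `…SahiE3ExchangeNestedTrace.exchange_nestedTrace_cornerO₂`
(type 2, corner `O` off the slot) the two companion statements: type 2 with the PRIMED corner `O'` off the slot (from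
`exchange_nestedLK_cornerO'`), and the TYPE-1 bracket with corner `O` off the slot (from `exchange_nestedLK_cornerO` and
`phantom_antitone₁`).  The mirror classes (nested trace `K∩V ⊆ L∩V`) are the same theorems with `(K,K') ↔ (L,L')` exchanged,
under which both exchange expressions are invariant.
-/

namespace Summit.CriticalPhenomena.PercolationContinuityZ3.Theorems.SahiE3ExchangeNestedTrace2

open Finset SahiE3DimerPacking SahiE3ExchangeCross SahiE3ExchangeEmptyLayer SahiE3ExchangeNested SahiE3ExchangePhantom
  SahiE3ExchangeNestedTrace
open scoped BigOperators

variable {B : Type*} [DecidableEq B]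

/-- **Nested unprimed TRACES, corner `O'` off the slot, bracket of type 2.**  `B` finite, `w ≥ 0` of total mass `1`, `R ≥ 0` on
`V`; a configuration `O ⊆ L`, `K, L ⊆ P`, `K', L' ⊆ P'` with `O' ∩ V = ∅`; nested enlargements `K ⊆ K₂ ⊆ P`,
`L ⊆ L₂ ⊆ P`, `K' ⊆ K₂' ⊆ P'`, `L' ⊆ L₂' ⊆ P'` with the same traces on `V` and `L₂ ⊆ K₂` (e.g. the relative saturations when
`L∩V ⊆ K∩V`); the pair inequality at `(K₂, K₂'∩L₂')` and `(L₂, K₂'∪L₂')`; Harris for `(P', P∩V)`, `(P,V)`, `(P',V)`, `(P,P')`.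
Then the ORIGINAL type-2 exchange expression is nonnegative:
`w(PP'V) + w(OO'V) − w(P)w(O'V) − w(P')w(OV) + R(KK'V) + R(LL'V) − need(K,L') − need(L,K') + (1−v)[Har(P,P') + (p−k)(p'−l') + (p−l)(p'−k')] ≥ 0`.
[this work] -/
theorem exchange_nestedTrace_cornerO'₂ [Fintype B] (w R : B → ℝ) (hw : ∀ b, 0 ≤ w b) (hw1 : ∑ b, w b = 1)
    (V K L P O K' L' P' O' K₂ L₂ K₂' L₂' : Finset B) (hR : ∀ b ∈ V, 0 ≤ R b)
    (hKK₂ : K ⊆ K₂) (hK₂P : K₂ ⊆ P) (hLL₂ : L ⊆ L₂) (hL₂P : L₂ ⊆ P)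
    (hKK₂' : K' ⊆ K₂') (hK₂P' : K₂' ⊆ P') (hLL₂' : L' ⊆ L₂') (hL₂P' : L₂' ⊆ P')
    (hTK : K₂ ∩ V = K ∩ V) (hTL : L₂ ∩ V = L ∩ V) (hTK' : K₂' ∩ V = K' ∩ V) (hTL' : L₂' ∩ V = L' ∩ V)
    (hL₂K₂ : L₂ ⊆ K₂) (hOL : O ⊆ L) (hO'V : O' ∩ V = ∅)
    (hpair₁ : (∑ b ∈ K₂, w b) * (∑ b ∈ (K₂' ∩ L₂') ∩ V, w b) + (∑ b ∈ K₂' ∩ L₂', w b) * (∑ b ∈ K₂ ∩ V, w b)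
        - (∑ b ∈ V, w b) * (∑ b ∈ K₂, w b) * (∑ b ∈ K₂' ∩ L₂', w b) ≤ ∑ b ∈ (K₂ ∩ (K₂' ∩ L₂')) ∩ V, R b)
    (hpair₂ : (∑ b ∈ L₂, w b) * (∑ b ∈ (K₂' ∪ L₂') ∩ V, w b) + (∑ b ∈ K₂' ∪ L₂', w b) * (∑ b ∈ L₂ ∩ V, w b)
        - (∑ b ∈ V, w b) * (∑ b ∈ L₂, w b) * (∑ b ∈ K₂' ∪ L₂', w b) ≤ ∑ b ∈ (L₂ ∩ (K₂' ∪ L₂')) ∩ V, R b)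
    (hHarV' : (∑ b ∈ P', w b) * (∑ b ∈ P ∩ V, w b) ≤ ∑ b ∈ (P ∩ P') ∩ V, w b)
    (hPV : (∑ b ∈ V, w b) * (∑ b ∈ P, w b) ≤ ∑ b ∈ P ∩ V, w b)
    (hP'V : (∑ b ∈ V, w b) * (∑ b ∈ P', w b) ≤ ∑ b ∈ P' ∩ V, w b)
    (hHar : (∑ b ∈ P, w b) * (∑ b ∈ P', w b) ≤ ∑ b ∈ P ∩ P', w b) :
    0 ≤ (∑ b ∈ (P ∩ P') ∩ V, w b) + (∑ b ∈ (O ∩ O') ∩ V, w b)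
        - (∑ b ∈ P, w b) * (∑ b ∈ O' ∩ V, w b) - (∑ b ∈ P', w b) * (∑ b ∈ O ∩ V, w b)
        + (∑ b ∈ (K ∩ K') ∩ V, R b) + (∑ b ∈ (L ∩ L') ∩ V, R b)
        - ((∑ b ∈ K, w b) * (∑ b ∈ L' ∩ V, w b) + (∑ b ∈ L', w b) * (∑ b ∈ K ∩ V, w b)
            - (∑ b ∈ V, w b) * (∑ b ∈ K, w b) * (∑ b ∈ L', w b))
        - ((∑ b ∈ L, w b) * (∑ b ∈ K' ∩ V, w b) + (∑ b ∈ K', w b) * (∑ b ∈ L ∩ V, w b)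
            - (∑ b ∈ V, w b) * (∑ b ∈ L, w b) * (∑ b ∈ K', w b))
        + (1 - ∑ b ∈ V, w b) * ((∑ b ∈ P ∩ P', w b) - (∑ b ∈ P, w b) * (∑ b ∈ P', w b)
            + ((∑ b ∈ P, w b) - ∑ b ∈ K, w b) * ((∑ b ∈ P', w b) - ∑ b ∈ L', w b)
            + ((∑ b ∈ P, w b) - ∑ b ∈ L, w b) * ((∑ b ∈ P', w b) - ∑ b ∈ K', w b)) := by
  -- masses and elementary comparisons
  have hv1 : ∑ b ∈ V, w b ≤ 1 := by
    rw [← hw1]; exact sum_le_sum_of_subset' w hw (Finset.subset_univ V)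
  have hk : ∑ b ∈ K, w b ≤ ∑ b ∈ K₂, w b := sum_le_sum_of_subset' w hw hKK₂
  have hl : ∑ b ∈ L, w b ≤ ∑ b ∈ L₂, w b := sum_le_sum_of_subset' w hw hLL₂
  have hk' : ∑ b ∈ K', w b ≤ ∑ b ∈ K₂', w b := sum_le_sum_of_subset' w hw hKK₂'
  have hl' : ∑ b ∈ L', w b ≤ ∑ b ∈ L₂', w b := sum_le_sum_of_subset' w hw hLL₂'
  have hk₂p : ∑ b ∈ K₂, w b ≤ ∑ b ∈ P, w b := sum_le_sum_of_subset' w hw hK₂P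
  have hl₂p : ∑ b ∈ L₂, w b ≤ ∑ b ∈ P, w b := sum_le_sum_of_subset' w hw hL₂P
  have hk₂p' : ∑ b ∈ K₂', w b ≤ ∑ b ∈ P', w b := sum_le_sum_of_subset' w hw hK₂P'
  have hl₂p' : ∑ b ∈ L₂', w b ≤ ∑ b ∈ P', w b := sum_le_sum_of_subset' w hw hL₂P'
  have hl₂k₂ : ∑ b ∈ L₂, w b ≤ ∑ b ∈ K₂, w b := sum_le_sum_of_subset' w hw hL₂K₂
  -- phantom parts are bounded by those of P, P':  w(X) − w(X∩V) ≤ w(P) − w(P∩V) for X ⊆ P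
  have phK₂ := trace_diff_le w V P K₂ hw hK₂P
  have phL₂ := trace_diff_le w V P L₂ hw hL₂P
  have phK' := trace_diff_le w V P' K' hw (hKK₂'.trans hK₂P')
  have phL' := trace_diff_le w V P' L' hw (hLL₂'.trans hL₂P')
  -- traces
  have eKK := inter_trace_eq V K K' K₂ K₂' hTK hTK'
  have eLL := inter_trace_eq V L L' L₂ L₂' hTL hTL'
  have hM'V : ∑ b ∈ (K₂' ∩ L₂') ∩ V, w b ≤ ∑ b ∈ L₂' ∩ V, w b :=
    sum_le_sum_of_subset' w hw (Finset.inter_subset_inter Finset.inter_subset_right le_rfl)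
  have h4' := union_inter_le w (Finset.univ : Finset B) K₂' L₂' P' (fun b _ => hw b) hK₂P' hL₂P'
  simp only [Finset.inter_univ] at h4'
  -- abbreviations (plain `have`-free names via `set` on scalars only)
  set v := ∑ b ∈ V, w b with hv
  set p := ∑ b ∈ P, w b with hp
  set p' := ∑ b ∈ P', w b with hp'
  set k := ∑ b ∈ K, w b with hkdef
  set l := ∑ b ∈ L, w b with hldef
  set k' := ∑ b ∈ K', w b with hk'def
  set l' := ∑ b ∈ L', w b with hl'def
  set k₂ := ∑ b ∈ K₂, w b with hk₂def
  set l₂ := ∑ b ∈ L₂, w b with hl₂def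
  set k₂' := ∑ b ∈ K₂', w b with hk₂'def
  set l₂' := ∑ b ∈ L₂', w b with hl₂'def
  set m₂' := ∑ b ∈ K₂' ∩ L₂', w b with hm₂'def
  set pp' := ∑ b ∈ P ∩ P', w b with hpp'
  -- the nested lemma for the enlarged configuration, with the type-2 bracket at the enlarged masses
  have hY : (k₂ - l₂) * (l₂' - m₂') ≤ (pp' - p * p') + (p - k₂) * (p' - l₂') + (p - l₂) * (p' - k₂') := by
    have a1 : 0 ≤ pp' - p * p' := by linarith
    have a2 : 0 ≤ (p - k₂) * (p' - l₂') := mul_nonneg (by linarith) (by linarith)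
    have b4 : 0 ≤ l₂' - m₂' := by
      have := sum_le_sum_of_subset' w hw (Finset.inter_subset_right : K₂' ∩ L₂' ⊆ L₂'); linarith
    have a3 : (k₂ - l₂) * (l₂' - m₂') ≤ (p - l₂) * (p' - k₂') :=
      calc (k₂ - l₂) * (l₂' - m₂') ≤ (p - l₂) * (l₂' - m₂') := mul_le_mul_of_nonneg_right (by linarith) b4
        _ ≤ (p - l₂) * (p' - k₂') := mul_le_mul_of_nonneg_left (by linarith) (by linarith)
    linarith
  have hnest := exchange_nestedLK_cornerO' w R hw hw1 V K₂ L₂ P O K₂' L₂' P' O'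
    ((pp' - p * p') + (p - k₂) * (p' - l₂') + (p - l₂) * (p' - k₂')) hR
    (hOL.trans hLL₂) hL₂K₂ hK₂P hK₂P' hL₂P' hO'V hpair₁ hpair₂ hHarV' hY
  rw [eKK, eLL, hTK, hTL, hTK', hTL'] at hnest
  -- phantom monotonicity: the R-free part at the enlarged masses is at most that at the original masses
  have sL' : l' - (∑ b ∈ L' ∩ V, w b) ≤ (1 - v) * p' := by linarith [phL', hP'V]
  have sK' : k' - (∑ b ∈ K' ∩ V, w b) ≤ (1 - v) * p' := by linarith [phK', hP'V]
  have sK₂ : k₂ - (∑ b ∈ K ∩ V, w b) ≤ (1 - v) * p := by rw [← hTK]; linarith [phK₂, hPV]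
  have sL₂ : l₂ - (∑ b ∈ L ∩ V, w b) ≤ (1 - v) * p := by rw [← hTL]; linarith [phL₂, hPV]
  have hmono := phantom_antitone₂ v p p'
    (∑ b ∈ K ∩ V, w b) (∑ b ∈ L ∩ V, w b) (∑ b ∈ K' ∩ V, w b) (∑ b ∈ L' ∩ V, w b)
    k l k' l' k₂ l₂ k₂' l₂' hk hl hk' hl' sL' sK' sK₂ sL₂
  linarith [hnest, hmono]


/-- **Nested unprimed TRACES, corner `O` off the slot, bracket of TYPE 1** (`Har(P,P') + (p−k)(k'−o') + (p−o)(p'−k')`).  `B` finite, `w ≥ 0` of total mass `1`, `R ≥ 0` on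
`V`; a configuration `K, L ⊆ P`, `O`, `O' ⊆ K'`, `K', L' ⊆ P'` with `O ∩ V = ∅`; nested enlargements `K ⊆ K₂ ⊆ P`,
`L ⊆ L₂ ⊆ P`, `K' ⊆ K₂' ⊆ P'`, `L' ⊆ L₂' ⊆ P'` with the same traces on `V` and `L₂ ⊆ K₂` (e.g. the relative saturations when
`L∩V ⊆ K∩V`); the pair inequality at `(K₂, K₂'∩L₂')` and `(L₂, K₂'∪L₂')`; `O ⊆ K`, `O ⊆ L`, `O' ⊆ K'`; Harris for `(P, P'∩V)`, `(P,P')` and Harris with the slot for `K₂, L₂, K', L'` (`v·w(X) ≤ w(X∩V)`).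
Then the ORIGINAL type-1 exchange expression is nonnegative:
`w(PP'V) + w(OO'V) − w(P)w(O'V) − w(P')w(OV) + R(KK'V) + R(LL'V) − need(K,L') − need(L,K') + (1−v)[Har(P,P') + (p−k)(k'−o') + (p−o)(p'−k')] ≥ 0`.
[this work] -/
theorem exchange_nestedTrace_cornerO₁ [Fintype B] (w R : B → ℝ) (hw : ∀ b, 0 ≤ w b) (hw1 : ∑ b, w b = 1)
    (V K L P O K' L' P' O' K₂ L₂ K₂' L₂' : Finset B) (hR : ∀ b ∈ V, 0 ≤ R b)
    (hKK₂ : K ⊆ K₂) (hK₂P : K₂ ⊆ P) (hLL₂ : L ⊆ L₂) (hL₂P : L₂ ⊆ P)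
    (hKK₂' : K' ⊆ K₂') (hK₂P' : K₂' ⊆ P') (hLL₂' : L' ⊆ L₂') (hL₂P' : L₂' ⊆ P')
    (hTK : K₂ ∩ V = K ∩ V) (hTL : L₂ ∩ V = L ∩ V) (hTK' : K₂' ∩ V = K' ∩ V) (hTL' : L₂' ∩ V = L' ∩ V)
    (hL₂K₂ : L₂ ⊆ K₂) (hOK : O ⊆ K) (hOL : O ⊆ L) (hOK' : O' ⊆ K') (hOV : O ∩ V = ∅)
    (hpair₁ : (∑ b ∈ K₂, w b) * (∑ b ∈ (K₂' ∩ L₂') ∩ V, w b) + (∑ b ∈ K₂' ∩ L₂', w b) * (∑ b ∈ K₂ ∩ V, w b)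
        - (∑ b ∈ V, w b) * (∑ b ∈ K₂, w b) * (∑ b ∈ K₂' ∩ L₂', w b) ≤ ∑ b ∈ (K₂ ∩ (K₂' ∩ L₂')) ∩ V, R b)
    (hpair₂ : (∑ b ∈ L₂, w b) * (∑ b ∈ (K₂' ∪ L₂') ∩ V, w b) + (∑ b ∈ K₂' ∪ L₂', w b) * (∑ b ∈ L₂ ∩ V, w b)
        - (∑ b ∈ V, w b) * (∑ b ∈ L₂, w b) * (∑ b ∈ K₂' ∪ L₂', w b) ≤ ∑ b ∈ (L₂ ∩ (K₂' ∪ L₂')) ∩ V, R b)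
    (hHarV : (∑ b ∈ P, w b) * (∑ b ∈ P' ∩ V, w b) ≤ ∑ b ∈ (P ∩ P') ∩ V, w b)
    (hK₂V : (∑ b ∈ V, w b) * (∑ b ∈ K₂, w b) ≤ ∑ b ∈ K₂ ∩ V, w b)
    (hL₂V : (∑ b ∈ V, w b) * (∑ b ∈ L₂, w b) ≤ ∑ b ∈ L₂ ∩ V, w b)
    (hK'V : (∑ b ∈ V, w b) * (∑ b ∈ K', w b) ≤ ∑ b ∈ K' ∩ V, w b)
    (hL'V : (∑ b ∈ V, w b) * (∑ b ∈ L', w b) ≤ ∑ b ∈ L' ∩ V, w b)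
    (hHar : (∑ b ∈ P, w b) * (∑ b ∈ P', w b) ≤ ∑ b ∈ P ∩ P', w b) :
    0 ≤ (∑ b ∈ (P ∩ P') ∩ V, w b) + (∑ b ∈ (O ∩ O') ∩ V, w b)
        - (∑ b ∈ P, w b) * (∑ b ∈ O' ∩ V, w b) - (∑ b ∈ P', w b) * (∑ b ∈ O ∩ V, w b)
        + (∑ b ∈ (K ∩ K') ∩ V, R b) + (∑ b ∈ (L ∩ L') ∩ V, R b)
        - ((∑ b ∈ K, w b) * (∑ b ∈ L' ∩ V, w b) + (∑ b ∈ L', w b) * (∑ b ∈ K ∩ V, w b)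
            - (∑ b ∈ V, w b) * (∑ b ∈ K, w b) * (∑ b ∈ L', w b))
        - ((∑ b ∈ L, w b) * (∑ b ∈ K' ∩ V, w b) + (∑ b ∈ K', w b) * (∑ b ∈ L ∩ V, w b)
            - (∑ b ∈ V, w b) * (∑ b ∈ L, w b) * (∑ b ∈ K', w b))
        + (1 - ∑ b ∈ V, w b) * ((∑ b ∈ P ∩ P', w b) - (∑ b ∈ P, w b) * (∑ b ∈ P', w b)
            + ((∑ b ∈ P, w b) - ∑ b ∈ K, w b) * ((∑ b ∈ K', w b) - ∑ b ∈ O', w b)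
            + ((∑ b ∈ P, w b) - ∑ b ∈ O, w b) * ((∑ b ∈ P', w b) - ∑ b ∈ K', w b)) := by
  -- masses and elementary comparisons
  have hv1 : ∑ b ∈ V, w b ≤ 1 := by
    rw [← hw1]; exact sum_le_sum_of_subset' w hw (Finset.subset_univ V)
  have hk : ∑ b ∈ K, w b ≤ ∑ b ∈ K₂, w b := sum_le_sum_of_subset' w hw hKK₂
  have hl : ∑ b ∈ L, w b ≤ ∑ b ∈ L₂, w b := sum_le_sum_of_subset' w hw hLL₂
  have hk' : ∑ b ∈ K', w b ≤ ∑ b ∈ K₂', w b := sum_le_sum_of_subset' w hw hKK₂'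
  have hl' : ∑ b ∈ L', w b ≤ ∑ b ∈ L₂', w b := sum_le_sum_of_subset' w hw hLL₂'
  have hk₂p : ∑ b ∈ K₂, w b ≤ ∑ b ∈ P, w b := sum_le_sum_of_subset' w hw hK₂P
  have hl₂p : ∑ b ∈ L₂, w b ≤ ∑ b ∈ P, w b := sum_le_sum_of_subset' w hw hL₂P
  have hk₂p' : ∑ b ∈ K₂', w b ≤ ∑ b ∈ P', w b := sum_le_sum_of_subset' w hw hK₂P'
  have hl₂p' : ∑ b ∈ L₂', w b ≤ ∑ b ∈ P', w b := sum_le_sum_of_subset' w hw hL₂P'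
  have hl₂k₂ : ∑ b ∈ L₂, w b ≤ ∑ b ∈ K₂, w b := sum_le_sum_of_subset' w hw hL₂K₂
  have ho : ∑ b ∈ O, w b ≤ ∑ b ∈ L, w b := sum_le_sum_of_subset' w hw hOL
  have hok : ∑ b ∈ O, w b ≤ ∑ b ∈ K, w b := sum_le_sum_of_subset' w hw hOK
  have ho' : ∑ b ∈ O', w b ≤ ∑ b ∈ K', w b := sum_le_sum_of_subset' w hw hOK'
  -- traces
  have eKK := inter_trace_eq V K K' K₂ K₂' hTK hTK'
  have eLL := inter_trace_eq V L L' L₂ L₂' hTL hTL'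
  have h4' := union_inter_le w (Finset.univ : Finset B) K₂' L₂' P' (fun b _ => hw b) hK₂P' hL₂P'
  simp only [Finset.inter_univ] at h4'
  set v := ∑ b ∈ V, w b with hv
  set p := ∑ b ∈ P, w b with hp
  set p' := ∑ b ∈ P', w b with hp'
  set o := ∑ b ∈ O, w b with hodef
  set o' := ∑ b ∈ O', w b with ho'def
  set k := ∑ b ∈ K, w b with hkdef
  set l := ∑ b ∈ L, w b with hldef
  set k' := ∑ b ∈ K', w b with hk'def
  set l' := ∑ b ∈ L', w b with hl'def
  set k₂ := ∑ b ∈ K₂, w b with hk₂def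
  set l₂ := ∑ b ∈ L₂, w b with hl₂def
  set k₂' := ∑ b ∈ K₂', w b with hk₂'def
  set l₂' := ∑ b ∈ L₂', w b with hl₂'def
  set m₂' := ∑ b ∈ K₂' ∩ L₂', w b with hm₂'def
  set pp' := ∑ b ∈ P ∩ P', w b with hpp'
  -- the nested lemma for the enlarged configuration, with the type-1 bracket at the enlarged masses
  have hY : (k₂ - l₂) * (l₂' - m₂') ≤ (pp' - p * p') + (p - k₂) * (k₂' - o') + (p - o) * (p' - k₂') := by
    have a1 : 0 ≤ pp' - p * p' := by linarith
    have a2 : 0 ≤ (p - k₂) * (k₂' - o') := mul_nonneg (by linarith) (by linarith)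
    have b4 : 0 ≤ l₂' - m₂' := by
      have := sum_le_sum_of_subset' w hw (Finset.inter_subset_right : K₂' ∩ L₂' ⊆ L₂'); linarith
    have a3 : (k₂ - l₂) * (l₂' - m₂') ≤ (p - o) * (p' - k₂') :=
      calc (k₂ - l₂) * (l₂' - m₂') ≤ (p - o) * (l₂' - m₂') := mul_le_mul_of_nonneg_right (by linarith) b4
        _ ≤ (p - o) * (p' - k₂') := mul_le_mul_of_nonneg_left (by linarith) (by linarith)
    linarith
  have hnest := exchange_nestedLK_cornerO w R hw hw1 V K₂ L₂ P O K₂' L₂' P' O'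
    ((pp' - p * p') + (p - k₂) * (k₂' - o') + (p - o) * (p' - k₂')) hR
    hL₂K₂ hK₂P (hOK'.trans hKK₂') hK₂P' hL₂P' hOV hpair₁ hpair₂ hHarV hY
  rw [eKK, eLL, hTK, hTL, hTK', hTL'] at hnest
  -- phantom monotonicity (type 1)
  have sK₂ : v * k₂ ≤ ∑ b ∈ K ∩ V, w b := by rw [← hTK]; exact hK₂V
  have sL₂ : v * l₂ ≤ ∑ b ∈ L ∩ V, w b := by rw [← hTL]; exact hL₂V
  have hmono := phantom_antitone₁ v p p' o o'
    (∑ b ∈ K ∩ V, w b) (∑ b ∈ L ∩ V, w b) (∑ b ∈ K' ∩ V, w b) (∑ b ∈ L' ∩ V, w b)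
    k l k' l' k₂ l₂ k₂' l₂' hv1 hk hl hk' hl' hL'V hK'V sK₂ sL₂ ho' hok
  linarith [hnest, hmono]

end Summit.CriticalPhenomena.PercolationContinuityZ3.Theorems.SahiE3ExchangeNestedTrace2
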